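import Summits.FinalStateConjecture.FinalStateConjecture.Theorems.EIHFluxBalanceInertialRecessionStubSlaving12JetCalculus
import Summits.FinalStateConjecture.FinalStateConjecture.Theorems.EIHFluxBalanceInertialRecessionStubSlavingCOERSymbol
import Literature.Geometry.Lorentzian.CoordCylinderFunctional
import Literature.Geometry.Lorentzian.KerrSchildChartCovariance

/-!
# Route EIHFluxBalance — `InertialRecession` (E′), line `SketchCleanExcision`, skeleton r13,
# stub `stub_higherOrderSlaving` (EF): the principal symbol — norm bound and the third-jet slot

Helper file for the crux `stmt-FinalStateConjecture-17403`
(`Summit.FinalStateConjecture.FinalStateConjecture.Theses.EIHFluxBalance.InertialRecession`, E′),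
registered stub `stub_higherOrderSlaving` (orders two and three of frozen-vacuum slaving).

The second-order step compares `Ric` of two fields of metric components whose `2`-jets at `x`
differ by `ζ ⊗ ζ ⊗ B` (`ricAt_apply_eq_add_symbol_of_jets`, `…StubSlavingCOERSymbol`: the
difference is the principal symbol `σ_G(ζ)B`); the third-order step compares `D[Ric]` of two
fields with the same `2`-jet whose THIRD derivatives differ by `ζ ⊗ ζ ⊗ ζ ⊗ B`. This file records

* `higherOrder_norm_ricAt_sub_le_of_jets` — the operator-norm bound
  `‖Ric G' − Ric G‖ ≤ 4 ‖♯‖ ‖ζ‖² ‖B‖` for the symbol (`|tr_G β| ≤ 4‖♯‖‖β‖` on `E4`);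
* `higherOrder_fderiv_ricciJet_symbol` — **the Ricci jet function is affine in its `D²`-slot along
  `ζ ⊗ ζ`-directions**: `D(ricciJet)(j)(0, 0, 0, ζ ⊗ ζ ⊗ B) = σ(ζ)B` (the symbol lemma applied to
  the Taylor fields `taylor2 j` and `taylor2 (j + τ(0,0,0,ζζB))`, then the derivative in `τ`);
* `higherOrder_fderiv_ricAt_apply_eq_add_symbol_of_jet₃` — **the `∂₀∂₀∂₀`-slot of `D Ric` is the
  principal symbol**: same `2`-jet and `D³G' = D³G + ζ ⊗ ζ ⊗ ζ ⊗ B` at `x` give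
  `D[Ric G'](x) v = D[Ric G](x) v + ζ(v) σ_G(ζ)B` (chain rule `fderiv_ricAt_eq_comp_jetMap`), with
  the norm bound `‖D[Ric G'](x) − D[Ric G](x)‖ ≤ 4 ‖♯‖ ‖ζ‖³ ‖B‖`;
* `higherOrder_isMetricOn_add` — adding a smooth symmetric perturbation keeps metric components
  on the open set where the sum stays invertible.

Pure coordinate tensor calculus; no definitions, no named facts, no `sorry`.
-/

set_option linter.dupNamespace false
set_option maxSynthPendingDepth 6
set_option synthInstance.maxHeartbeats 200000

noncomputable section

namespace Summit.FinalStateConjecture.FinalStateConjecture.Theorems.SublinearIsFree.Slaving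

open scoped Topology ContDiff
open Filter Set Function Literature.Geometry.Lorentzian Literature.Geometry.Lorentzian.MetricCoord

/-! ### Metric components: restriction and perturbation -/

/-- **Adding a smooth symmetric perturbation to metric components** gives metric components on
the (open) part of the domain where the sum is invertible. [folklore] -/
theorem higherOrder_isMetricOn_add {E : Type*} [NormedAddCommGroup E] [NormedSpace ℝ E]
    [CompleteSpace E] {G Q : E → E →L[ℝ] E →L[ℝ] ℝ} {V : Set E} (hG : IsMetricOn G V)
    (hQ : ContDiffOn ℝ ∞ Q V) (hQs : ∀ z ∈ V, ∀ v w : E, Q z v w = Q z w v) :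
    IsMetricOn (fun z ↦ G z + Q z) (V ∩ {z | (G z + Q z).IsInvertible}) := by
  have hc : ContinuousOn (fun z ↦ G z + Q z) V := (hG.contDiffOn.add hQ).continuousOn
  have hopen : IsOpen (V ∩ {z | (G z + Q z).IsInvertible}) := by
    have hset : {z : E | (G z + Q z).IsInvertible} = (fun z ↦ G z + Q z) ⁻¹'
        (range ((↑) : (E ≃L[ℝ] (E →L[ℝ] ℝ)) → E →L[ℝ] E →L[ℝ] ℝ)) := by
      ext z
      simp only [mem_setOf_eq, mem_preimage, mem_range, ContinuousLinearMap.IsInvertible]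
    rw [hset]
    exact hc.isOpen_inter_preimage hG.isOpen ContinuousLinearEquiv.isOpen
  refine ⟨hopen, (hG.contDiffOn.add hQ).mono inter_subset_left, fun z hz v w ↦ ?_,
    fun z hz ↦ hz.2⟩
  simp only [_root_.add_apply, hG.symm z hz.1 v w, hQs z hz.1 v w]

/-! ### The norm of the principal symbol -/

/-- `|tr_G β| ≤ 4 ‖♯‖ ‖β‖` on `E4`. [folklore] -/
theorem higherOrder_abs_mtrAt_le (G : E4 → E4 →L[ℝ] E4 →L[ℝ] ℝ) (x : E4) (β : E4 →L[ℝ] E4 →L[ℝ] ℝ) :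
    |mtrAt G x β| ≤ 4 * (‖sharpAt G x‖ * ‖β‖) := by
  have h := abs_mtrAt_le G x β
  have h4 : (Module.finrank ℝ E4 : ℝ) = 4 := by simp
  rwa [h4] at h

/-- **The value of the principal symbol is bounded by `4 ‖♯‖ ‖ζ‖² ‖B‖`**: the explicit bilinear
form `(Y, Z) ↦ ½[ζ(Z) ζ(♯B(·,Y)) + ζ(Y) B(♯ζ, Z) − ζ(♯ζ) B(Y,Z) − ζ(Y) ζ(Z) tr_G Bᵗ]` of
`ricAt_apply_eq_add_symbol_of_jets` satisfies `|·| ≤ (7/2) ‖♯‖ ‖ζ‖² ‖B‖ ‖Y‖ ‖Z‖`. [folklore] -/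
theorem higherOrder_abs_symbol_apply_le (G : E4 → E4 →L[ℝ] E4 →L[ℝ] ℝ) (x : E4) (ζ : E4 →L[ℝ] ℝ)
    (B : E4 →L[ℝ] E4 →L[ℝ] ℝ) (Y Z : E4) :
    |2⁻¹ * (ζ Z * ζ (sharpAt G x (B.flip Y)) + ζ Y * B (sharpAt G x ζ) Z
      - ζ (sharpAt G x ζ) * B Y Z - ζ Y * ζ Z * mtrAt G x B.flip)| ≤
      4 * ‖sharpAt G x‖ * ‖ζ‖ ^ 2 * ‖B‖ * ‖Y‖ * ‖Z‖ := by
  set s := ‖sharpAt G x‖ with hs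
  have hs0 : 0 ≤ s := norm_nonneg _
  have hζY : |ζ Y| ≤ ‖ζ‖ * ‖Y‖ := by rw [← Real.norm_eq_abs]; exact ζ.le_opNorm Y
  have hζZ : |ζ Z| ≤ ‖ζ‖ * ‖Z‖ := by rw [← Real.norm_eq_abs]; exact ζ.le_opNorm Z
  have hflip : ‖B.flip‖ = ‖B‖ := B.opNorm_flip
  have h1 : |ζ (sharpAt G x (B.flip Y))| ≤ ‖ζ‖ * (s * (‖B‖ * ‖Y‖)) := by
    rw [← Real.norm_eq_abs]
    refine (ζ.le_opNorm _).trans (mul_le_mul_of_nonneg_left ?_ (norm_nonneg _))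
    refine ((sharpAt G x).le_opNorm _).trans (mul_le_mul_of_nonneg_left ?_ hs0)
    exact ((B.flip).le_opNorm Y).trans (by rw [hflip])
  have h2 : |B (sharpAt G x ζ) Z| ≤ ‖B‖ * (s * ‖ζ‖) * ‖Z‖ := by
    rw [← Real.norm_eq_abs]
    refine (B.le_opNorm₂ _ _).trans ?_
    gcongr
    exact (sharpAt G x).le_opNorm ζ
  have h3 : |ζ (sharpAt G x ζ)| ≤ ‖ζ‖ * (s * ‖ζ‖) := by
    rw [← Real.norm_eq_abs]
    exact (ζ.le_opNorm _).trans (mul_le_mul_of_nonneg_left ((sharpAt G x).le_opNorm ζ) (norm_nonneg _))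
  have h4 : |B Y Z| ≤ ‖B‖ * ‖Y‖ * ‖Z‖ := by rw [← Real.norm_eq_abs]; exact B.le_opNorm₂ Y Z
  have h5 : |mtrAt G x B.flip| ≤ 4 * (s * ‖B‖) := by
    have h := higherOrder_abs_mtrAt_le G x B.flip; rwa [hflip] at h
  have hY := norm_nonneg Y
  have hZ := norm_nonneg Z
  have hζ := norm_nonneg ζ
  have hB := norm_nonneg B
  rw [abs_mul, abs_of_pos (by norm_num : (0 : ℝ) < 2⁻¹)]
  have key : |ζ Z * ζ (sharpAt G x (B.flip Y)) + ζ Y * B (sharpAt G x ζ) Z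
      - ζ (sharpAt G x ζ) * B Y Z - ζ Y * ζ Z * mtrAt G x B.flip| ≤
      7 * s * ‖ζ‖ ^ 2 * ‖B‖ * ‖Y‖ * ‖Z‖ := by
    calc _ ≤ |ζ Z * ζ (sharpAt G x (B.flip Y))| + |ζ Y * B (sharpAt G x ζ) Z|
          + |ζ (sharpAt G x ζ) * B Y Z| + |ζ Y * ζ Z * mtrAt G x B.flip| := by
          refine (abs_sub _ _).trans (add_le_add ((abs_sub _ _).trans (add_le_add (abs_add_le _ _)
            le_rfl)) le_rfl)
      _ ≤ (‖ζ‖ * ‖Z‖) * (‖ζ‖ * (s * (‖B‖ * ‖Y‖))) + (‖ζ‖ * ‖Y‖) * (‖B‖ * (s * ‖ζ‖) * ‖Z‖)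
          + (‖ζ‖ * (s * ‖ζ‖)) * (‖B‖ * ‖Y‖ * ‖Z‖) + (‖ζ‖ * ‖Y‖) * (‖ζ‖ * ‖Z‖) * (4 * (s * ‖B‖)) := by
          rw [abs_mul, abs_mul, abs_mul, abs_mul, abs_mul]
          gcongr
      _ = 7 * s * ‖ζ‖ ^ 2 * ‖B‖ * ‖Y‖ * ‖Z‖ := by ring
  calc 2⁻¹ * |ζ Z * ζ (sharpAt G x (B.flip Y)) + ζ Y * B (sharpAt G x ζ) Z
        - ζ (sharpAt G x ζ) * B Y Z - ζ Y * ζ Z * mtrAt G x B.flip|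
      ≤ 2⁻¹ * (7 * s * ‖ζ‖ ^ 2 * ‖B‖ * ‖Y‖ * ‖Z‖) := mul_le_mul_of_nonneg_left key (by norm_num)
    _ ≤ 4 * s * ‖ζ‖ ^ 2 * ‖B‖ * ‖Y‖ * ‖Z‖ := by nlinarith [mul_nonneg (mul_nonneg (mul_nonneg
        (mul_nonneg hs0 (pow_nonneg hζ 2)) hB) hY) hZ]

/-- Operator norm of a bilinear form from a bound on its values. [folklore] -/
theorem higherOrder_opNorm_bilin_le {R : E4 →L[ℝ] E4 →L[ℝ] ℝ} {C : ℝ} (hC : 0 ≤ C)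
    (h : ∀ Y Z, |R Y Z| ≤ C * ‖Y‖ * ‖Z‖) : ‖R‖ ≤ C := by
  refine ContinuousLinearMap.opNorm_le_bound _ hC fun Y ↦ ?_
  refine ContinuousLinearMap.opNorm_le_bound _ (by positivity) fun Z ↦ ?_
  rw [Real.norm_eq_abs]
  exact h Y Z

/-- **Norm bound for the `∂₀∂₀`-slot of `Ric`.** Two fields of metric components on `V ∋ x`
with the same `1`-jet at `x` and `D²G'(x)(v)(w) = D²G(x)(v)(w) + ζ(v)ζ(w) B` satisfy
`‖Ric G'(x) − Ric G(x)‖ ≤ 4 ‖♯_G(x)‖ ‖ζ‖² ‖B‖` (`ricAt_apply_eq_add_symbol_of_jets` and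
`higherOrder_abs_symbol_apply_le`). [folklore] -/
theorem higherOrder_norm_ricAt_sub_le_of_jets {G G' : E4 → E4 →L[ℝ] E4 →L[ℝ] ℝ} {V : Set E4}
    {x : E4} (hG : IsMetricOn G V) (hG' : IsMetricOn G' V) (hx : x ∈ V) (h0 : G' x = G x)
    (h1 : fderiv ℝ G' x = fderiv ℝ G x) {ζ : E4 →L[ℝ] ℝ} {B : E4 →L[ℝ] E4 →L[ℝ] ℝ}
    (h2 : ∀ v, fderiv ℝ (fderiv ℝ G') x v = fderiv ℝ (fderiv ℝ G) x v + ζ v • ζ.smulRight B) :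
    ‖ricAt G' x - ricAt G x‖ ≤ 4 * ‖sharpAt G x‖ * ‖ζ‖ ^ 2 * ‖B‖ := by
  refine higherOrder_opNorm_bilin_le (by positivity) fun Y Z ↦ ?_
  rw [_root_.sub_apply, _root_.sub_apply, ricAt_apply_eq_add_symbol_of_jets hG hG' hx h0 h1 h2 Y Z,
    add_sub_cancel_left]
  exact higherOrder_abs_symbol_apply_le G x ζ B Y Z

/-! ### The Ricci jet function is affine in its second-derivative slot along `ζ ⊗ ζ` -/

/-- `smulRight` is homogeneous in the form. [folklore] -/
theorem higherOrder_smulRight_smul (ζ : E4 →L[ℝ] ℝ) (τ : ℝ) (B : E4 →L[ℝ] E4 →L[ℝ] ℝ) :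
    ζ.smulRight (τ • B) = τ • ζ.smulRight B := by
  ext v w u
  simp only [ContinuousLinearMap.smulRight_apply, _root_.smul_apply, smul_eq_mul]
  ring

/-- Same value ⇒ same metric trace. [folklore] -/
theorem higherOrder_mtrAt_eq_of_apply_eq {G G' : E4 → E4 →L[ℝ] E4 →L[ℝ] ℝ} {x : E4}
    (h0 : G' x = G x) (β : E4 →L[ℝ] E4 →L[ℝ] ℝ) : mtrAt G' x β = mtrAt G x β := by
  unfold mtrAt; rw [sharpAt_eq_of_apply_eq h0]

set_option maxHeartbeats 1600000 in
/-- **The Ricci jet function along a `ζ ⊗ ζ ⊗ B` change of the `D²`-slot.** For a jet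
`j = (p, A, D₁, D₂)` with `A` symmetric invertible and `D₁ v`, `D₂ v w` symmetric, `D₂` symmetric
in its differentiation slots: `ricciJet (p, A, D₁, D₂ + τ ζ⊗ζ⊗B) (Y, Z) = ricciJet j (Y, Z) +
τ · ½[ζ(Z) ζ(A⁻¹B(·,Y)) + ζ(Y) B(A⁻¹ζ, Z) − ζ(A⁻¹ζ) B(Y,Z) − ζ(Y) ζ(Z) tr_A Bᵗ]`
(`ricAt_apply_eq_add_symbol_of_jets` for the two Taylor fields). [folklore] -/
theorem higherOrder_ricciJet_add_symbolDir {p : E4} {A : E4 →L[ℝ] E4 →L[ℝ] ℝ}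
    {D₁ : E4 →L[ℝ] E4 →L[ℝ] E4 →L[ℝ] ℝ} {D₂ : E4 →L[ℝ] E4 →L[ℝ] E4 →L[ℝ] E4 →L[ℝ] ℝ}
    (hA : ∀ v w, A v w = A w v) (hAi : A.IsInvertible) (hD₁ : ∀ z v w, D₁ z v w = D₁ z w v)
    (hD₂ : ∀ z z' v w, D₂ z z' v w = D₂ z z' w v) (hD₂c : ∀ v w, D₂ v w = D₂ w v)
    (ζ : E4 →L[ℝ] ℝ) {B : E4 →L[ℝ] E4 →L[ℝ] ℝ} (hB : ∀ v w, B v w = B w v) (τ : ℝ) (Y Z : E4) :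
    ricciJet (E := E4) (p, A, D₁, D₂ + τ • ζ.smulRight (ζ.smulRight B)) Y Z =
      ricciJet (E := E4) (p, A, D₁, D₂) Y Z + τ * (2⁻¹ * (ζ Z * ζ (A.inverse (B.flip Y))
        + ζ Y * B (A.inverse ζ) Z - ζ (A.inverse ζ) * B Y Z
        - ζ Y * ζ Z * LinearMap.trace ℝ E4 (((A.inverse).comp B.flip : E4 →L[ℝ] E4) : E4 →ₗ[ℝ] E4))) := by
  set C : E4 →L[ℝ] E4 →L[ℝ] E4 →L[ℝ] E4 →L[ℝ] ℝ := ζ.smulRight (ζ.smulRight B) with hC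
  have hCapp : ∀ v w, C v w = (ζ v * ζ w) • B := fun v w ↦ by
    simp only [hC, ContinuousLinearMap.smulRight_apply, _root_.smul_apply, smul_smul]
  set T : E4 → E4 →L[ℝ] E4 →L[ℝ] ℝ := taylor2 p A D₁ D₂ with hT
  set T' : E4 → E4 →L[ℝ] E4 →L[ℝ] ℝ := taylor2 p A D₁ (D₂ + τ • C) with hT'
  -- both Taylor fields are metric components near `p`
  have hD₂' : ∀ z z' v w, (D₂ + τ • C) z z' v w = (D₂ + τ • C) z z' w v := fun z z' v w ↦ by
    simp only [_root_.add_apply, _root_.smul_apply, hCapp, hD₂ z z' v w, hB v w]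
  have hD₂c' : ∀ v w, (D₂ + τ • C) v w = (D₂ + τ • C) w v := fun v w ↦ by
    ext a b
    simp only [_root_.add_apply, _root_.smul_apply, hCapp, hD₂c v w, mul_comm (ζ v) (ζ w)]
  have hMT := isMetricOn_taylor2 (y₀ := p) (A := A) (D₁ := D₁) (D₂ := D₂) hA hD₁ hD₂
  have hMT' := isMetricOn_taylor2 (y₀ := p) (A := A) (D₁ := D₁) (D₂ := D₂ + τ • C) hA hD₁ hD₂'
  set W : Set E4 := {y | (taylor2 p A D₁ D₂ y).IsInvertible} ∩
    {y | (taylor2 p A D₁ (D₂ + τ • C) y).IsInvertible} with hW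
  have hWo : IsOpen W := hMT.isOpen.inter hMT'.isOpen
  have hG : IsMetricOn T W := KerrSchildChart.isMetricOn_mono hMT hWo inter_subset_left
  have hG' : IsMetricOn T' W := KerrSchildChart.isMetricOn_mono hMT' hWo inter_subset_right
  have hpW : p ∈ W := by
    constructor
    · show (taylor2 p A D₁ D₂ p).IsInvertible; rw [taylor2_self]; exact hAi
    · show (taylor2 p A D₁ (D₂ + τ • C) p).IsInvertible; rw [taylor2_self]; exact hAi
  -- jets of the two Taylor fields at `p`
  have h0 : T' p = T p := by rw [hT, hT', taylor2_self, taylor2_self]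
  have h1 : fderiv ℝ T' p = fderiv ℝ T p := by rw [hT, hT', fderiv_taylor2_self, fderiv_taylor2_self]
  have h2 : ∀ v, fderiv ℝ (fderiv ℝ T') p v = fderiv ℝ (fderiv ℝ T) p v + ζ v • ζ.smulRight (τ • B) := by
    intro v
    rw [hT, hT', fderiv_fderiv_taylor2 hD₂c' p, fderiv_fderiv_taylor2 hD₂c p, _root_.add_apply,
      _root_.smul_apply, higherOrder_smulRight_smul, smul_comm]
    rfl
  have key := ricAt_apply_eq_add_symbol_of_jets hG hG' hpW h0 h1 h2 Y Z
  -- `♯` and `tr` of the Taylor field at its centre are those of `A`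
  have hTp : T p = A := by rw [hT, taylor2_self]
  have hsharp : sharpAt T p = A.inverse := by unfold sharpAt; rw [hTp]
  have hmtr : mtrAt T p (τ • B).flip = τ * LinearMap.trace ℝ E4
      (((A.inverse).comp B.flip : E4 →L[ℝ] E4) : E4 →ₗ[ℝ] E4) := by
    have hf : (τ • B).flip = τ • B.flip := by ext a b; rfl
    rw [hf, mtrAt_smul]
    unfold mtrAt; rw [hsharp]
  unfold ricciJet
  simp only []
  rw [key, hsharp, hmtr]
  have hf2 : ∀ v, (τ • B).flip v = τ • B.flip v := fun v ↦ by ext a; rfl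
  simp only [hf2, map_smul, _root_.smul_apply, smul_eq_mul]
  ring

set_option maxHeartbeats 1600000 in
/-- **`D(ricciJet)(j)(0, 0, 0, ζ ⊗ ζ ⊗ B)` is the principal symbol `σ(ζ)B`**, at every jet
`j = (x, G x, DG x, D²G x)` of metric components (derivative in `τ` of
`higherOrder_ricciJet_add_symbolDir`; `ricciJet` is differentiable at `j`,
`contDiffOn_ricciJet`). [folklore] -/
theorem higherOrder_fderiv_ricciJet_symbol {G : E4 → E4 →L[ℝ] E4 →L[ℝ] ℝ} {V : Set E4} {x : E4}
    (hG : IsMetricOn G V) (hx : x ∈ V) (ζ : E4 →L[ℝ] ℝ) {B : E4 →L[ℝ] E4 →L[ℝ] ℝ}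
    (hB : ∀ v w, B v w = B w v) (Y Z : E4) :
    fderiv ℝ (ricciJet (E := E4)) (x, G x, fderiv ℝ G x, fderiv ℝ (fderiv ℝ G) x)
      ((0 : E4), (0 : E4 →L[ℝ] E4 →L[ℝ] ℝ), (0 : E4 →L[ℝ] E4 →L[ℝ] E4 →L[ℝ] ℝ),
        ζ.smulRight (ζ.smulRight B)) Y Z =
      2⁻¹ * (ζ Z * ζ (sharpAt G x (B.flip Y)) + ζ Y * B (sharpAt G x ζ) Z
        - ζ (sharpAt G x ζ) * B Y Z - ζ Y * ζ Z * mtrAt G x B.flip) := by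
  set j : (E4 × (E4 →L[ℝ] E4 →L[ℝ] ℝ) × (E4 →L[ℝ] E4 →L[ℝ] E4 →L[ℝ] ℝ) × (E4 →L[ℝ] E4 →L[ℝ] E4 →L[ℝ] E4 →L[ℝ] ℝ)) := (x, G x, fderiv ℝ G x, fderiv ℝ (fderiv ℝ G) x) with hj
  set q : (E4 × (E4 →L[ℝ] E4 →L[ℝ] ℝ) × (E4 →L[ℝ] E4 →L[ℝ] E4 →L[ℝ] ℝ) × (E4 →L[ℝ] E4 →L[ℝ] E4 →L[ℝ] E4 →L[ℝ] ℝ)) := ((0 : E4), (0 : E4 →L[ℝ] E4 →L[ℝ] ℝ), (0 : E4 →L[ℝ] E4 →L[ℝ] E4 →L[ℝ] ℝ),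
    ζ.smulRight (ζ.smulRight B)) with hq
  set σ : ℝ := 2⁻¹ * (ζ Z * ζ (sharpAt G x (B.flip Y)) + ζ Y * B (sharpAt G x ζ) Z
        - ζ (sharpAt G x ζ) * B Y Z - ζ Y * ζ Z * mtrAt G x B.flip) with hσ
  -- `ricciJet` is differentiable at `j`
  have hmem : j ∈ {j : (E4 × (E4 →L[ℝ] E4 →L[ℝ] ℝ) × (E4 →L[ℝ] E4 →L[ℝ] E4 →L[ℝ] ℝ) × (E4 →L[ℝ] E4 →L[ℝ] E4 →L[ℝ] E4 →L[ℝ] ℝ)) | j.2.1.IsInvertible} := hG.isInvertible x hx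
  have hR : DifferentiableAt ℝ (ricciJet (E := E4)) j :=
    (contDiffOn_ricciJet.contDiffAt (isOpen_ricciJetDomain.mem_nhds hmem)).differentiableAt (by simp)
  -- the line `τ ↦ j + τ • q` and the scalar function along it
  have hline : HasDerivAt (fun τ : ℝ ↦ j + τ • q) q 0 := by
    have h := ((hasDerivAt_id (0 : ℝ)).smul_const q).const_add j
    simpa using h
  have hcomp : HasDerivAt (fun τ : ℝ ↦ ricciJet (E := E4) (j + τ • q) Y Z)
      (fderiv ℝ (ricciJet (E := E4)) j q Y Z) 0 := by
    have h1 : HasDerivAt (fun τ : ℝ ↦ ricciJet (E := E4) (j + τ • q))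
        (fderiv ℝ (ricciJet (E := E4)) j q) 0 := by
      have hR' : HasFDerivAt (ricciJet (E := E4)) (fderiv ℝ (ricciJet (E := E4)) j)
          (j + (0 : ℝ) • q) := by
        rw [zero_smul, add_zero]; exact hR.hasFDerivAt
      exact hR'.comp_hasDerivAt (0 : ℝ) hline
    exact (h1.clm_apply (hasDerivAt_const (0 : ℝ) Y)).clm_apply (hasDerivAt_const (0 : ℝ) Z)
      |>.congr_deriv (by simp)
  -- the explicit affine dependence
  have haff : ∀ τ : ℝ, ricciJet (E := E4) (j + τ • q) Y Z = ricciJet (E := E4) j Y Z + τ * σ := by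
    intro τ
    have hjq : j + τ • q = (x, G x, fderiv ℝ G x,
        fderiv ℝ (fderiv ℝ G) x + τ • ζ.smulRight (ζ.smulRight B)) := by
      simp [hj, hq]
    rw [hjq, hj]
    have h := higherOrder_ricciJet_add_symbolDir (p := x) (hG.symm x hx) (hG.isInvertible x hx)
      (hG.fderiv_symm hx) (hG.fderiv_fderiv_symm hx) (hG.fderiv_fderiv_comm hx) ζ hB τ Y Z
    rw [h]
    rfl
  have hlin : HasDerivAt (fun τ : ℝ ↦ ricciJet (E := E4) (j + τ • q) Y Z) σ 0 := by
    have h : HasDerivAt (fun τ : ℝ ↦ ricciJet (E := E4) j Y Z + τ * σ) σ 0 := by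
      simpa using ((hasDerivAt_id (0 : ℝ)).mul_const σ).const_add (ricciJet (E := E4) j Y Z)
    exact h.congr_of_eventuallyEq (Eventually.of_forall haff)
  exact hcomp.unique hlin

set_option maxHeartbeats 1600000 in
/-- **The `∂₀∂₀∂₀`-slot of `D Ric` is the principal symbol.** If two fields of metric components
on an open `V ∋ x` have the same `2`-jet at `x` and third derivatives differing by
`D³G'(x)(v) = D³G(x)(v) + ζ(v) • ζ ⊗ ζ ⊗ B` with `B` symmetric, then
`D[Ric G'](x)(v)(Y,Z) = D[Ric G](x)(v)(Y,Z) + ζ(v) σ_G(ζ)B(Y,Z)` with the explicit symbol of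
`ricAt_apply_eq_add_symbol_of_jets` (chain rule `fderiv_ricAt_eq_comp_jetMap` through the Ricci jet
function and `higherOrder_fderiv_ricciJet_symbol`). [folklore] -/
theorem higherOrder_fderiv_ricAt_apply_eq_add_symbol_of_jet₃ {G G' : E4 → E4 →L[ℝ] E4 →L[ℝ] ℝ}
    {V : Set E4} {x : E4} (hG : IsMetricOn G V) (hG' : IsMetricOn G' V) (hx : x ∈ V)
    (h0 : G' x = G x) (h1 : fderiv ℝ G' x = fderiv ℝ G x)
    (h2 : fderiv ℝ (fderiv ℝ G') x = fderiv ℝ (fderiv ℝ G) x) {ζ : E4 →L[ℝ] ℝ}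
    {B : E4 →L[ℝ] E4 →L[ℝ] ℝ} (hB : ∀ v w, B v w = B w v)
    (h3 : ∀ v, fderiv ℝ (fderiv ℝ (fderiv ℝ G')) x v =
      fderiv ℝ (fderiv ℝ (fderiv ℝ G)) x v + ζ v • ζ.smulRight (ζ.smulRight B)) (v Y Z : E4) :
    fderiv ℝ (ricAt G') x v Y Z = fderiv ℝ (ricAt G) x v Y Z + ζ v * (2⁻¹ * (ζ Z *
      ζ (sharpAt G x (B.flip Y)) + ζ Y * B (sharpAt G x ζ) Z - ζ (sharpAt G x ζ) * B Y Z
      - ζ Y * ζ Z * mtrAt G x B.flip)) := by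
  have hc := fderiv_ricAt_eq_comp_jetMap hG hx
  have hc' := fderiv_ricAt_eq_comp_jetMap hG' hx
  rw [h0, h1, h2] at hc'
  have hsym := higherOrder_fderiv_ricciJet_symbol hG hx ζ hB Y Z
  rw [hc', hc]
  simp only [ContinuousLinearMap.coe_comp, Function.comp_apply, ContinuousLinearMap.prod_apply,
    ContinuousLinearMap.id_apply, h3 v]
  have hsplit : ((v, fderiv ℝ G x v, fderiv ℝ (fderiv ℝ G) x v,
      fderiv ℝ (fderiv ℝ (fderiv ℝ G)) x v + ζ v • ζ.smulRight (ζ.smulRight B)) : (E4 × (E4 →L[ℝ] E4 →L[ℝ] ℝ) × (E4 →L[ℝ] E4 →L[ℝ] E4 →L[ℝ] ℝ) × (E4 →L[ℝ] E4 →L[ℝ] E4 →L[ℝ] E4 →L[ℝ] ℝ))) =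
      (v, fderiv ℝ G x v, fderiv ℝ (fderiv ℝ G) x v, fderiv ℝ (fderiv ℝ (fderiv ℝ G)) x v) +
      ζ v • ((0 : E4), (0 : E4 →L[ℝ] E4 →L[ℝ] ℝ), (0 : E4 →L[ℝ] E4 →L[ℝ] E4 →L[ℝ] ℝ),
        ζ.smulRight (ζ.smulRight B)) := by
    simp
  rw [hsplit, map_add, map_smul, _root_.add_apply, _root_.add_apply, _root_.smul_apply,
    _root_.smul_apply, hsym, smul_eq_mul]

/-- **Norm bound for the `∂₀∂₀∂₀`-slot of `D Ric`**: under the hypotheses of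
`higherOrder_fderiv_ricAt_apply_eq_add_symbol_of_jet₃`,
`‖D[Ric G'](x) − D[Ric G](x)‖ ≤ 4 ‖♯_G(x)‖ ‖ζ‖³ ‖B‖`. [folklore] -/
theorem higherOrder_norm_fderiv_ricAt_sub_le_of_jet₃ {G G' : E4 → E4 →L[ℝ] E4 →L[ℝ] ℝ}
    {V : Set E4} {x : E4} (hG : IsMetricOn G V) (hG' : IsMetricOn G' V) (hx : x ∈ V)
    (h0 : G' x = G x) (h1 : fderiv ℝ G' x = fderiv ℝ G x)
    (h2 : fderiv ℝ (fderiv ℝ G') x = fderiv ℝ (fderiv ℝ G) x) {ζ : E4 →L[ℝ] ℝ}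
    {B : E4 →L[ℝ] E4 →L[ℝ] ℝ} (hB : ∀ v w, B v w = B w v)
    (h3 : ∀ v, fderiv ℝ (fderiv ℝ (fderiv ℝ G')) x v =
      fderiv ℝ (fderiv ℝ (fderiv ℝ G)) x v + ζ v • ζ.smulRight (ζ.smulRight B)) :
    ‖fderiv ℝ (ricAt G') x - fderiv ℝ (ricAt G) x‖ ≤ 4 * ‖sharpAt G x‖ * ‖ζ‖ ^ 3 * ‖B‖ := by
  refine ContinuousLinearMap.opNorm_le_bound _ (by positivity) fun v ↦ ?_
  have hv : ‖(fderiv ℝ (ricAt G') x - fderiv ℝ (ricAt G) x) v‖ ≤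
      (4 * ‖sharpAt G x‖ * ‖ζ‖ ^ 2 * ‖B‖) * (‖ζ‖ * ‖v‖) := by
    refine higherOrder_opNorm_bilin_le (by positivity) fun Y Z ↦ ?_
    rw [_root_.sub_apply, _root_.sub_apply, _root_.sub_apply,
      higherOrder_fderiv_ricAt_apply_eq_add_symbol_of_jet₃ hG hG' hx h0 h1 h2 hB h3 v Y Z,
      add_sub_cancel_left, abs_mul]
    have hζv : |ζ v| ≤ ‖ζ‖ * ‖v‖ := by rw [← Real.norm_eq_abs]; exact ζ.le_opNorm v
    have hs := higherOrder_abs_symbol_apply_le G x ζ B Y Z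
    calc |ζ v| * _ ≤ (‖ζ‖ * ‖v‖) * (4 * ‖sharpAt G x‖ * ‖ζ‖ ^ 2 * ‖B‖ * ‖Y‖ * ‖Z‖) :=
          mul_le_mul hζv hs (abs_nonneg _) (by positivity)
      _ = 4 * ‖sharpAt G x‖ * ‖ζ‖ ^ 2 * ‖B‖ * (‖ζ‖ * ‖v‖) * ‖Y‖ * ‖Z‖ := by ring
  calc _ ≤ (4 * ‖sharpAt G x‖ * ‖ζ‖ ^ 2 * ‖B‖) * (‖ζ‖ * ‖v‖) := hv
    _ = 4 * ‖sharpAt G x‖ * ‖ζ‖ ^ 3 * ‖B‖ * ‖v‖ := by ring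


/-- **Registered one-line carrier form** (`higherOrder_symbolJet3_EF`) of `higherOrder_fderiv_ricAt_apply_eq_add_symbol_of_jet₃`: the `∂₀∂₀∂₀`-slot of `D Ric` is the principal symbol. [folklore] -/
theorem higherOrder_symbolJet3_EF : open Literature.Geometry.Lorentzian in ∀ {G G' : E4 → E4 →L[ℝ] E4 →L[ℝ] ℝ} {V : Set E4} {x : E4}, MetricCoord.IsMetricOn G V → MetricCoord.IsMetricOn G' V → x ∈ V → G' x = G x → fderiv ℝ G' x = fderiv ℝ G x → fderiv ℝ (fderiv ℝ G') x = fderiv ℝ (fderiv ℝ G) x → ∀ {ζ : E4 →L[ℝ] ℝ} {B : E4 →L[ℝ] E4 →L[ℝ] ℝ}, (∀ v w, B v w = B w v) → (∀ v, fderiv ℝ (fderiv ℝ (fderiv ℝ G')) x v = fderiv ℝ (fderiv ℝ (fderiv ℝ G)) x v + ζ v • ζ.smulRight (ζ.smulRight B)) → ∀ (v Y Z : E4), fderiv ℝ (MetricCoord.ricAt G') x v Y Z = fderiv ℝ (MetricCoord.ricAt G) x v Y Z + ζ v * (2⁻¹ * (ζ Z * ζ (MetricCoord.sharpAt G x (B.flip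 Y)) + ζ Y * B (MetricCoord.sharpAt G x ζ) Z - ζ (MetricCoord.sharpAt G x ζ) * B Y Z - ζ Y * ζ Z * MetricCoord.mtrAt G x B.flip)) :=
  fun hG hG' hx h0 h1 h2 _ _ hB h3 v Y Z ↦
    higherOrder_fderiv_ricAt_apply_eq_add_symbol_of_jet₃ hG hG' hx h0 h1 h2 hB h3 v Y Z

end Summit.FinalStateConjecture.FinalStateConjecture.Theorems.SublinearIsFree.Slaving

end
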